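import Literature.NumberTheory.LFunctions.PrimeLogSeries
import HarnessLib

/-!
# Montgomery–Vaughan 2001, Lemma 1 (Roy–Vatwani 2019, Lemma 7.1): `ζ` at vertically displaced points

Support file (everything PROVED, no definitions, no named facts) for the discharge of
`Literature.Barriers.RiemannHypothesis.MontgomeryVaughan2001_zeroFree` (Montgomery–Vaughan 2001,
as quoted in Roy–Vatwani 2019, Thm. 1.1). Roy–Vatwani, Lemma 7.1 (`k = 1`, `F = ζ`; "by putting
`k = 1`, we recover Lemmas 1 and 2 of [MontgomeryVaughan2001]"): for `1 < σ₁ ≤ σ₂ ≤ 2`,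
`(σ₁−1)/(σ₂−1) ≪ |ζ(σ₂+it)/ζ(σ₁+it)| ≪ (σ₂−1)/(σ₁−1)`, proved as printed from the logarithm of the
Euler product: `|log ζ(σ₂+it) − log ζ(σ₁+it)| ≤ ∑_n (Λ(n)/log n)(n^{−σ₁} − n^{−σ₂}) = log(ζ(σ₁)/ζ(σ₂))`
and `ζ(σ) ≍ 1/(σ−1)`. Here `log ζ` is the tree's `primeZetaLog s = ∑_p −log(1 − p^{−s})`
(`PrimeLogSeries.lean`, `exp (primeZetaLog s) = ζ(s)` for `Re s > 1`), and the prime-power sum is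
organised prime by prime through the Mercator series `−log(1−z) = ∑ zⁿ/n`.

## Main results (namespace `Literature.NumberTheory.LFunctions.MontgomeryVaughan2001`)
- `norm_neg_log_sub_neg_log_le` : `‖log(1−z₂) − log(1−z₁)‖ ≤ ∑_n ‖z₁ⁿ − z₂ⁿ‖/n` (`‖z_j‖ < 1`).
- `norm_neg_log_sub_le_of_real_mul` : for `z₂ = ρ z₁`, `0 ≤ ρ ≤ 1`: `… ≤ −log(1−‖z₁‖) + log(1−‖z₂‖)`.
- `norm_riemannZeta_eq_exp_re` : `‖ζ(s)‖ = exp (Re primeZetaLog s)` (`Re s > 1`).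
- `norm_primeZetaLog_add_real_sub_le` : `‖primeZetaLog (s+δ) − primeZetaLog s‖ ≤ Re P(σ) − Re P(σ+δ)`.
- `norm_zeta_add_real_le`, `norm_zeta_le_add_real` : `‖ζ(s+δ)‖`, `‖ζ(s)‖` against each other with
  the factor `‖ζ(σ)‖/‖ζ(σ+δ)‖` (`σ = Re s > 1`, `δ ≥ 0`).
- `inv_sub_one_le_norm_zeta`, `norm_zeta_real_le` : `1/(σ−1) ≤ ‖ζ(σ)‖ ≤ σ/(σ−1)` (real `σ > 1`).
- `norm_zeta_vertical_le`, `norm_zeta_vertical_ge` : **Lemma 7.1** — for `1 < σ₁ ≤ σ₂ ≤ 2` and real `t`,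
  `‖ζ(σ₂+it)‖ ≤ 2((σ₂−1)/(σ₁−1)) ‖ζ(σ₁+it)‖` and `‖ζ(σ₁+it)‖ ≤ 2((σ₂−1)/(σ₁−1)) ‖ζ(σ₂+it)‖`.

## References
- [RoyVatwani2019] A. Roy, A. Vatwani, *Zeros of partial sums of L-functions*, Adv. Math. 346
  (2019), Lemma 7.1 and its proof (arXiv p. 16).
- [MontgomeryVaughan2001] H. L. Montgomery, R. C. Vaughan, *Mean values of multiplicative
  functions*, Period. Math. Hungar. 43 (2001), Lemma 1 (cited through Roy–Vatwani; not held).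
-/

noncomputable section

open Complex Real Filter Topology

namespace Literature.NumberTheory.LFunctions.MontgomeryVaughan2001

open Nicolas

/-! ### The Mercator series and differences of logarithms -/

/-- For `‖z₁‖, ‖z₂‖ < 1` the series `∑_n ‖z₁ⁿ − z₂ⁿ‖/n` converges (compare with two geometric
series). [folklore] -/
theorem summable_norm_pow_sub_pow_div {z₁ z₂ : ℂ} (h₁ : ‖z₁‖ < 1) (h₂ : ‖z₂‖ < 1) :
    Summable fun n : ℕ => ‖z₁ ^ n - z₂ ^ n‖ / n := by
  refine Summable.of_nonneg_of_le (fun n => by positivity) (fun n => ?_)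
    ((summable_geometric_of_lt_one (norm_nonneg _) h₁).add
      (summable_geometric_of_lt_one (norm_nonneg _) h₂))
  rcases Nat.eq_zero_or_pos n with rfl | hn
  · simp
  · calc ‖z₁ ^ n - z₂ ^ n‖ / n ≤ ‖z₁ ^ n - z₂ ^ n‖ :=
          div_le_self (norm_nonneg _) (by exact_mod_cast hn)
      _ ≤ ‖z₁ ^ n‖ + ‖z₂ ^ n‖ := norm_sub_le _ _
      _ = ‖z₁‖ ^ n + ‖z₂‖ ^ n := by rw [norm_pow, norm_pow]

/-- Difference of the Mercator series: for `‖z₁‖, ‖z₂‖ < 1`,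
`‖(−log(1−z₁)) − (−log(1−z₂))‖ ≤ ∑_n ‖z₁ⁿ − z₂ⁿ‖/n`. [folklore] -/
theorem norm_neg_log_sub_neg_log_le {z₁ z₂ : ℂ} (h₁ : ‖z₁‖ < 1) (h₂ : ‖z₂‖ < 1) :
    ‖(-Complex.log (1 - z₁)) - (-Complex.log (1 - z₂))‖ ≤ ∑' n : ℕ, ‖z₁ ^ n - z₂ ^ n‖ / n := by
  have H := (Complex.hasSum_taylorSeries_neg_log h₁).sub (Complex.hasSum_taylorSeries_neg_log h₂)
  rw [← H.tsum_eq]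
  have heq : (fun n : ℕ => ‖z₁ ^ n / n - z₂ ^ n / n‖) = fun n : ℕ => ‖z₁ ^ n - z₂ ^ n‖ / (n : ℝ) := by
    ext n; rw [← sub_div, norm_div, Complex.norm_natCast]
  refine (norm_tsum_le_tsum_norm ?_).trans (le_of_eq ?_)
  · rw [heq]; exact summable_norm_pow_sub_pow_div h₁ h₂
  · exact congrArg tsum heq

/-- Radially displaced points: if `z₂ = ρ z₁` with `0 ≤ ρ ≤ 1` and `‖z₁‖ < 1`, then
`‖z₁ⁿ − z₂ⁿ‖ = ‖z₁‖ⁿ − ‖z₂‖ⁿ`. [folklore] -/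
theorem norm_pow_sub_pow_of_real_mul {z₁ : ℂ} {ρ : ℝ} (hρ0 : 0 ≤ ρ) (hρ1 : ρ ≤ 1) (n : ℕ) :
    ‖z₁ ^ n - ((ρ : ℂ) * z₁) ^ n‖ = ‖z₁‖ ^ n - ‖(ρ : ℂ) * z₁‖ ^ n := by
  have hρn1 : ρ ^ n ≤ 1 := pow_le_one₀ hρ0 hρ1
  rw [mul_pow, show z₁ ^ n - (ρ : ℂ) ^ n * z₁ ^ n = ((1 - ρ ^ n : ℝ) : ℂ) * z₁ ^ n by
    push_cast; ring, norm_mul, Complex.norm_real, Real.norm_eq_abs,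
    abs_of_nonneg (by linarith), norm_mul, mul_pow, norm_pow, Complex.norm_real,
    Real.norm_eq_abs, abs_of_nonneg hρ0]
  ring

/-- For `z₂ = ρ z₁` with `0 ≤ ρ ≤ 1`, `‖z₁‖ < 1`:
`‖(−log(1−z₁)) − (−log(1−z₂))‖ ≤ (−log(1−‖z₁‖)) − (−log(1−‖z₂‖))` (sum the previous identity
against the real Mercator series). [folklore] -/
theorem norm_neg_log_sub_le_of_real_mul {z₁ : ℂ} {ρ : ℝ} (h₁ : ‖z₁‖ < 1) (hρ0 : 0 ≤ ρ)
    (hρ1 : ρ ≤ 1) :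
    ‖(-Complex.log (1 - z₁)) - (-Complex.log (1 - (ρ : ℂ) * z₁))‖ ≤
      (-Real.log (1 - ‖z₁‖)) - (-Real.log (1 - ‖(ρ : ℂ) * z₁‖)) := by
  have h₂ : ‖(ρ : ℂ) * z₁‖ < 1 := by
    rw [norm_mul, Complex.norm_real, Real.norm_eq_abs, abs_of_nonneg hρ0]
    calc ρ * ‖z₁‖ ≤ 1 * ‖z₁‖ := by gcongr
      _ < 1 := by rw [one_mul]; exact h₁
  refine (norm_neg_log_sub_neg_log_le h₁ h₂).trans (le_of_eq ?_)
  simp_rw [norm_pow_sub_pow_of_real_mul hρ0 hρ1]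
  -- the two real Mercator series
  have hx1 : |‖z₁‖| < 1 := by rwa [abs_of_nonneg (norm_nonneg _)]
  have hx2 : |‖(ρ : ℂ) * z₁‖| < 1 := by rwa [abs_of_nonneg (norm_nonneg _)]
  have H1 := Real.hasSum_pow_div_log_of_abs_lt_one hx1
  have H2 := Real.hasSum_pow_div_log_of_abs_lt_one hx2
  have H := H1.sub H2
  -- shift the index: the `n = 0` term of `∑ (aⁿ − bⁿ)/n` vanishes
  have H' : HasSum (fun n : ℕ => (‖z₁‖ ^ n - ‖(ρ : ℂ) * z₁‖ ^ n) / n)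
      (-Real.log (1 - ‖z₁‖) - -Real.log (1 - ‖(ρ : ℂ) * z₁‖)) := by
    rw [← hasSum_nat_add_iff' 1]
    simp only [Finset.range_one, Finset.sum_singleton, pow_zero, sub_self, Nat.cast_zero,
      div_zero, sub_zero]
    convert H using 1
    ext n
    push_cast
    ring
  exact H'.tsum_eq

/-! ### `ζ = exp ∘ primeZetaLog` on `Re s > 1` -/

/-- `‖ζ(s)‖ = exp (Re primeZetaLog s)` for `Re s > 1`. [cite: MontgomeryVaughan2007, §1.3] -/
theorem norm_riemannZeta_eq_exp_re {s : ℂ} (hs : 1 < s.re) :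
    ‖riemannZeta s‖ = Real.exp (primeZetaLog s).re := by
  rw [← exp_primeZetaLog hs, Complex.norm_exp]

/-- `‖ζ(s₂)‖ / ‖ζ(s₁)‖ ≤ exp ‖primeZetaLog s₂ − primeZetaLog s₁‖` (`Re s_j > 1`).
[cite: RoyVatwani2019, proof of Lemma 7.1] -/
theorem norm_zeta_div_le_exp_norm_sub {s₁ s₂ : ℂ} (h₁ : 1 < s₁.re) (h₂ : 1 < s₂.re) :
    ‖riemannZeta s₂‖ / ‖riemannZeta s₁‖ ≤ Real.exp ‖primeZetaLog s₂ - primeZetaLog s₁‖ := by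
  rw [norm_riemannZeta_eq_exp_re h₁, norm_riemannZeta_eq_exp_re h₂, ← Real.exp_sub,
    Real.exp_le_exp, ← Complex.sub_re]
  exact Complex.re_le_norm _

/-- The terms of `primeZetaLog` at `s` and at `s + δ` (`δ ≥ 0` real): `p^{−(s+δ)} = p^{−δ} · p^{−s}`
with `0 ≤ p^{−δ} ≤ 1`. [folklore] -/
theorem primes_cpow_neg_add_real (p : Nat.Primes) (s : ℂ) (δ : ℝ) :
    ((p : ℕ) : ℂ) ^ (-(s + δ)) = ((((p : ℕ) : ℝ) ^ (-δ) : ℝ) : ℂ) * ((p : ℕ) : ℂ) ^ (-s) := by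
  have hp : ((p : ℕ) : ℂ) ≠ 0 := by exact_mod_cast p.2.ne_zero
  rw [neg_add, Complex.cpow_add _ _ hp, mul_comm, Complex.ofReal_cpow (Nat.cast_nonneg _)]
  push_cast
  ring_nf

/-- **The vertical comparison, logarithmic form** (Roy–Vatwani, proof of Lemma 7.1, `k = 1`):
for `Re s = σ > 1` and `δ ≥ 0`,
`‖primeZetaLog (s + δ) − primeZetaLog s‖ ≤ Re primeZetaLog σ − Re primeZetaLog (σ + δ)`
(`= log ζ(σ) − log ζ(σ+δ)`), since termwise `|p^{−n s} − p^{−n(s+δ)}| = p^{−nσ} − p^{−n(σ+δ)}`.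
[cite: RoyVatwani2019, proof of Lemma 7.1] -/
theorem norm_primeZetaLog_add_real_sub_le {s : ℂ} (hs : 1 < s.re) {δ : ℝ} (hδ : 0 ≤ δ) :
    ‖primeZetaLog (s + δ) - primeZetaLog s‖ ≤
      (primeZetaLog (s.re : ℂ)).re - (primeZetaLog ((s.re + δ : ℝ) : ℂ)).re := by
  have hs' : 1 < (s + δ).re := by simp; linarith
  have hσ : 1 < ((s.re : ℂ)).re := by simpa using hs
  have hσ' : (1 : ℝ) < s.re + δ := by linarith
  -- termwise bound
  set v : Nat.Primes → ℝ := fun p =>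
    (-Real.log (1 - ((p : ℕ) : ℝ) ^ (-s.re))) - (-Real.log (1 - ((p : ℕ) : ℝ) ^ (-(s.re + δ))))
    with hv
  have hterm : ∀ p : Nat.Primes, ‖(-Complex.log (1 - ((p : ℕ) : ℂ) ^ (-(s + δ)))) -
      (-Complex.log (1 - ((p : ℕ) : ℂ) ^ (-s)))‖ ≤ v p := by
    intro p
    have hz : ‖((p : ℕ) : ℂ) ^ (-s)‖ < 1 := norm_primes_cpow_neg_lt_one p (by linarith)
    have hρ0 : 0 ≤ ((p : ℕ) : ℝ) ^ (-δ) := Real.rpow_nonneg (Nat.cast_nonneg _) _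
    have hρ1 : ((p : ℕ) : ℝ) ^ (-δ) ≤ 1 :=
      Real.rpow_le_one_of_one_le_of_nonpos (by exact_mod_cast p.2.one_lt.le) (by linarith)
    have h := norm_neg_log_sub_le_of_real_mul hz hρ0 hρ1
    rw [← primes_cpow_neg_add_real p s δ, norm_sub_rev] at h
    refine h.trans (le_of_eq ?_)
    simp only [hv]
    rw [primes_cpow_neg_add_real p s δ, norm_mul, Complex.norm_real, Real.norm_eq_abs,
      abs_of_nonneg hρ0, norm_primes_cpow_neg, ← Real.rpow_add (by exact_mod_cast p.2.pos)]
    ring_nf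
  -- sum over primes
  have hsum1 := summable_primeZetaLog hs'
  have hsum2 := summable_primeZetaLog hs
  have hdiff : primeZetaLog (s + δ) - primeZetaLog s = ∑' p : Nat.Primes,
      ((-Complex.log (1 - ((p : ℕ) : ℂ) ^ (-(s + δ)))) - (-Complex.log (1 - ((p : ℕ) : ℂ) ^ (-s)))) := by
    rw [primeZetaLog, primeZetaLog, ← hsum1.tsum_sub hsum2]
  -- the real series for `Re P(σ)` and `Re P(σ+δ)`
  have hre : ∀ {x : ℝ}, 1 < x → HasSum (fun p : Nat.Primes => -Real.log (1 - ((p : ℕ) : ℝ) ^ (-x)))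
      (primeZetaLog (x : ℂ)).re := by
    intro x hx
    have hsx : Summable fun p : Nat.Primes => -Real.log (1 - ((p : ℕ) : ℝ) ^ (-x)) := by
      have h := summable_primeZetaLog (w := (x : ℂ)) (by simpa using hx)
      have heq : (fun p : Nat.Primes => -Complex.log (1 - ((p : ℕ) : ℂ) ^ (-(x : ℂ)))) =
          fun p : Nat.Primes => ((-Real.log (1 - ((p : ℕ) : ℝ) ^ (-x)) : ℝ) : ℂ) := by
        ext p
        have hp : (0 : ℝ) < 1 - ((p : ℕ) : ℝ) ^ (-x) := by
          have h1 : ((p : ℕ) : ℝ) ^ (-x) < 1 :=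
            Real.rpow_lt_one_of_one_lt_of_neg (by exact_mod_cast p.2.one_lt) (by linarith)
          linarith
        rw [primes_cpow_neg_ofReal, Complex.ofReal_neg, Complex.ofReal_log hp.le]
        simp
      rw [heq] at h
      exact (Complex.summable_ofReal).1 h
    have hval : (primeZetaLog (x : ℂ)).re = ∑' p : Nat.Primes, -Real.log (1 - ((p : ℕ) : ℝ) ^ (-x)) := by
      rw [primeZetaLog_ofReal hx, Complex.ofReal_re]
    rw [hval]
    exact hsx.hasSum
  have hv_sum : HasSum v ((primeZetaLog (s.re : ℂ)).re - (primeZetaLog ((s.re + δ : ℝ) : ℂ)).re) :=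
    (hre hs).sub (hre hσ')
  rw [hdiff, ← hv_sum.tsum_eq]
  refine (norm_tsum_le_tsum_norm ?_).trans (Summable.tsum_le_tsum hterm ?_ hv_sum.summable)
  · exact (hsum1.sub hsum2).norm
  · exact (hsum1.sub hsum2).norm

/-- **Roy–Vatwani Lemma 7.1, upper bound, multiplicative form**: for `Re s = σ > 1`, `δ ≥ 0`,
`‖ζ(s + δ)‖ ≤ (‖ζ(σ)‖ / ‖ζ(σ+δ)‖) · ‖ζ(s)‖`. [cite: RoyVatwani2019, Lemma 7.1] -/
theorem norm_zeta_add_real_le {s : ℂ} (hs : 1 < s.re) {δ : ℝ} (hδ : 0 ≤ δ) :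
    ‖riemannZeta (s + δ)‖ ≤
      ‖riemannZeta (s.re : ℂ)‖ / ‖riemannZeta ((s.re + δ : ℝ) : ℂ)‖ * ‖riemannZeta s‖ := by
  have hs' : 1 < (s + δ).re := by simp; linarith
  have hσ : 1 < ((s.re : ℂ)).re := by simpa using hs
  have hσ' : 1 < (((s.re + δ : ℝ)) : ℂ).re := by simp; linarith
  have hpos : 0 < ‖riemannZeta s‖ := norm_pos_iff.2 (riemannZeta_ne_zero_of_one_lt_re hs)
  rw [← div_le_iff₀ hpos]
  refine (norm_zeta_div_le_exp_norm_sub hs hs').trans ?_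
  rw [norm_riemannZeta_eq_exp_re hσ, norm_riemannZeta_eq_exp_re hσ', ← Real.exp_sub, Real.exp_le_exp]
  exact norm_primeZetaLog_add_real_sub_le hs hδ

/-- **Roy–Vatwani Lemma 7.1, lower bound, multiplicative form**: for `Re s = σ > 1`, `δ ≥ 0`,
`‖ζ(s)‖ ≤ (‖ζ(σ)‖ / ‖ζ(σ+δ)‖) · ‖ζ(s + δ)‖`. [cite: RoyVatwani2019, Lemma 7.1] -/
theorem norm_zeta_le_add_real {s : ℂ} (hs : 1 < s.re) {δ : ℝ} (hδ : 0 ≤ δ) :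
    ‖riemannZeta s‖ ≤
      ‖riemannZeta (s.re : ℂ)‖ / ‖riemannZeta ((s.re + δ : ℝ) : ℂ)‖ * ‖riemannZeta (s + δ)‖ := by
  have hs' : 1 < (s + δ).re := by simp; linarith
  have hσ : 1 < ((s.re : ℂ)).re := by simpa using hs
  have hσ' : 1 < (((s.re + δ : ℝ)) : ℂ).re := by simp; linarith
  have hpos : 0 < ‖riemannZeta (s + δ)‖ := norm_pos_iff.2 (riemannZeta_ne_zero_of_one_lt_re hs')
  rw [← div_le_iff₀ hpos]
  refine (norm_zeta_div_le_exp_norm_sub hs' hs).trans ?_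
  rw [norm_riemannZeta_eq_exp_re hσ, norm_riemannZeta_eq_exp_re hσ', ← Real.exp_sub,
    Real.exp_le_exp, norm_sub_rev]
  exact norm_primeZetaLog_add_real_sub_le hs hδ

/-! ### `ζ(σ) ≍ 1/(σ − 1)` on the real axis -/

/-- The real fractional-part integral is at most `1/σ` (`σ > 0`): `∫_1^∞ {x} x^{−σ−1} dx ≤ 1/σ`.
[cite: Titchmarsh1986, §2.1 eq. (2.1.4)] -/
theorem fractIntegralReal_le {σ : ℝ} (hσ : 0 < σ) :
    ∫ x in Set.Ioi (1 : ℝ), Int.fract x * x ^ (-(σ + 1)) ≤ 1 / σ := by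
  have h := norm_fractIntegral_le (s := (σ : ℂ)) (by simpa using hσ)
  rw [fractIntegral_ofReal, Complex.norm_real, Real.norm_eq_abs, Complex.ofReal_re] at h
  exact (le_abs_self _).trans h

/-- `1/(σ−1) ≤ ‖ζ(σ)‖` for real `σ > 1` (from (2.1.4): `ζ(σ) = σ/(σ−1) − σ∫{x}x^{−σ−1} ≥ σ/(σ−1) − 1`).
[cite: Titchmarsh1986, §2.1 eq. (2.1.4)] -/
theorem inv_sub_one_le_norm_zeta {σ : ℝ} (hσ : 1 < σ) :
    1 / (σ - 1) ≤ ‖riemannZeta (σ : ℂ)‖ := by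
  have h0 : 0 < σ := by linarith
  rw [riemannZeta_ofReal_eq_of_pos h0 hσ.ne', Complex.norm_real, Real.norm_eq_abs]
  refine le_trans ?_ (le_abs_self _)
  have hI := fractIntegralReal_le h0
  have hI' : σ * ∫ x in Set.Ioi (1 : ℝ), Int.fract x * x ^ (-(σ + 1)) ≤ 1 := by
    calc σ * ∫ x in Set.Ioi (1 : ℝ), Int.fract x * x ^ (-(σ + 1)) ≤ σ * (1 / σ) := by gcongr
      _ = 1 := by field_simp
  have hσ1 : 0 < σ - 1 := by linarith
  have : σ / (σ - 1) - 1 = 1 / (σ - 1) := by field_simp; ring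
  linarith

/-- `‖ζ(σ)‖ ≤ σ/(σ−1)` for real `σ > 1` (drop the non-negative integral in (2.1.4)).
[cite: Titchmarsh1986, §2.1 eq. (2.1.4)] -/
theorem norm_zeta_real_le {σ : ℝ} (hσ : 1 < σ) :
    ‖riemannZeta (σ : ℂ)‖ ≤ σ / (σ - 1) := by
  have h0 : 0 < σ := by linarith
  rw [riemannZeta_ofReal_eq_of_pos h0 hσ.ne', Complex.norm_real, Real.norm_eq_abs]
  have hI := fractIntegralReal_nonneg σ
  have hI2 := fractIntegralReal_le h0
  have hσ1 : 0 < σ - 1 := by linarith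
  have hpos : 0 < σ / (σ - 1) := by positivity
  have hI' : σ * ∫ x in Set.Ioi (1 : ℝ), Int.fract x * x ^ (-(σ + 1)) ≤ 1 := by
    calc σ * ∫ x in Set.Ioi (1 : ℝ), Int.fract x * x ^ (-(σ + 1)) ≤ σ * (1 / σ) := by gcongr
      _ = 1 := by field_simp
  have h1 : 1 ≤ σ / (σ - 1) := by rw [le_div_iff₀ hσ1]; linarith
  rw [abs_le]
  constructor <;> nlinarith

/-- The quotient `‖ζ(σ₁)‖/‖ζ(σ₂)‖ ≤ σ₁ (σ₂−1)/(σ₁−1) ≤ 2 (σ₂−1)/(σ₁−1)` for `1 < σ₁`, `1 < σ₂`, `σ₁ ≤ 2`.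
[cite: RoyVatwani2019, proof of Lemma 7.1] -/
theorem norm_zeta_real_div_le {σ₁ σ₂ : ℝ} (h₁ : 1 < σ₁) (h₁2 : σ₁ ≤ 2) (h₂ : 1 < σ₂) :
    ‖riemannZeta (σ₁ : ℂ)‖ / ‖riemannZeta (σ₂ : ℂ)‖ ≤ 2 * ((σ₂ - 1) / (σ₁ - 1)) := by
  have hlow := inv_sub_one_le_norm_zeta h₂
  have hup := norm_zeta_real_le h₁
  have hσ1 : 0 < σ₁ - 1 := by linarith
  have hσ2 : 0 < σ₂ - 1 := by linarith
  have hpos2 : 0 < ‖riemannZeta (σ₂ : ℂ)‖ := lt_of_lt_of_le (by positivity) hlow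
  rw [div_le_iff₀ hpos2]
  calc ‖riemannZeta (σ₁ : ℂ)‖ ≤ σ₁ / (σ₁ - 1) := hup
    _ = σ₁ / (σ₁ - 1) * (σ₂ - 1) * (1 / (σ₂ - 1)) := by field_simp
    _ ≤ σ₁ / (σ₁ - 1) * (σ₂ - 1) * ‖riemannZeta (σ₂ : ℂ)‖ := by gcongr
    _ ≤ 2 * ((σ₂ - 1) / (σ₁ - 1)) * ‖riemannZeta (σ₂ : ℂ)‖ := by
        refine mul_le_mul_of_nonneg_right ?_ (norm_nonneg _)
        rw [div_mul_eq_mul_div, mul_div_assoc']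
        exact div_le_div_of_nonneg_right (by nlinarith) hσ1.le

/-! ### Lemma 7.1 (Montgomery–Vaughan Lemma 1) for `ζ` -/

/-- **Roy–Vatwani 2019, Lemma 7.1 (`k = 1`, `F = ζ`), upper bound**: for `1 < σ₁ ≤ σ₂ ≤ 2` and
real `t`, `‖ζ(σ₂ + it)‖ ≤ 2 ((σ₂−1)/(σ₁−1)) ‖ζ(σ₁ + it)‖` ("`|F(σ₂)/F(σ₁)| ≪ ((σ₂−1)/(σ₁−1))^k`",
applied to `F(s) = ζ(s + it)`). [cite: RoyVatwani2019, Lemma 7.1] -/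
theorem norm_zeta_vertical_le {σ₁ σ₂ : ℝ} (h₁ : 1 < σ₁) (h₁₂ : σ₁ ≤ σ₂) (h₂ : σ₂ ≤ 2) (t : ℝ) :
    ‖riemannZeta (σ₂ + t * I)‖ ≤ 2 * ((σ₂ - 1) / (σ₁ - 1)) * ‖riemannZeta (σ₁ + t * I)‖ := by
  set s : ℂ := σ₁ + t * I with hs_def
  have hs : 1 < s.re := by simp [hs_def, h₁]
  have hsre : s.re = σ₁ := by simp [hs_def]
  have h := norm_zeta_add_real_le hs (δ := σ₂ - σ₁) (by linarith)
  rw [hsre] at h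
  have hs2 : s + ((σ₂ - σ₁ : ℝ) : ℂ) = σ₂ + t * I := by rw [hs_def]; push_cast; ring
  have hσ2 : ((σ₁ + (σ₂ - σ₁) : ℝ) : ℂ) = (σ₂ : ℂ) := by push_cast; ring
  rw [hs2, hσ2] at h
  refine h.trans ?_
  gcongr
  exact norm_zeta_real_div_le h₁ (h₁₂.trans h₂) (by linarith)

/-- **Roy–Vatwani 2019, Lemma 7.1 (`k = 1`, `F = ζ`), lower bound**: for `1 < σ₁ ≤ σ₂ ≤ 2` and
real `t`, `‖ζ(σ₁ + it)‖ ≤ 2 ((σ₂−1)/(σ₁−1)) ‖ζ(σ₂ + it)‖` ("`((σ₁−1)/(σ₂−1))^k ≪ |F(σ₂)/F(σ₁)|`").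
[cite: RoyVatwani2019, Lemma 7.1] -/
theorem norm_zeta_vertical_ge {σ₁ σ₂ : ℝ} (h₁ : 1 < σ₁) (h₁₂ : σ₁ ≤ σ₂) (h₂ : σ₂ ≤ 2) (t : ℝ) :
    ‖riemannZeta (σ₁ + t * I)‖ ≤ 2 * ((σ₂ - 1) / (σ₁ - 1)) * ‖riemannZeta (σ₂ + t * I)‖ := by
  set s : ℂ := σ₁ + t * I with hs_def
  have hs : 1 < s.re := by simp [hs_def, h₁]
  have hsre : s.re = σ₁ := by simp [hs_def]
  have h := norm_zeta_le_add_real hs (δ := σ₂ - σ₁) (by linarith)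
  rw [hsre] at h
  have hs2 : s + ((σ₂ - σ₁ : ℝ) : ℂ) = σ₂ + t * I := by rw [hs_def]; push_cast; ring
  have hσ2 : ((σ₁ + (σ₂ - σ₁) : ℝ) : ℂ) = (σ₂ : ℂ) := by push_cast; ring
  rw [hs2, hσ2] at h
  refine h.trans ?_
  gcongr
  exact norm_zeta_real_div_le h₁ (h₁₂.trans h₂) (by linarith)

end Literature.NumberTheory.LFunctions.MontgomeryVaughan2001
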